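import Summits.ResolutionOfSingularities.ResolutionOfSingularities.Theorems.FrobeniusClosingSteerSteeredExit
import Summits.ResolutionOfSingularities.ResolutionOfSingularities.Theorems.FrobeniusClosingSteerCore4GenExit
import Summits.ResolutionOfSingularities.ResolutionOfSingularities.Theorems.FrobeniusClosingSteerCore4SteeredRegular
import HarnessLib

/-!
# Crux `Steer` (stmt-ResolutionOfSingularities-16345), line `switching_dichotomy` — B′: RE-BASING THE DATUM AT A
# MEMBER OF A STEERED RUN (towers of local blowings up; Theses-free body)

OURS (campaign `res-hironaka`, rung L ★L-G4, slot W4.1, chain W4.1, seat `res-D-pv-028` — the STAGED CONVERT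
«Alternation» of res-plan-2's MAP v1.11; replaces the role of no printed item; NOT a statement of the manuscript
under review; AI review is weaker than expert review).

The chain planner's odd-`p` design (res-L0-w41-plan-1, CHAIN W4.1 v5.4a §B / v5.5 §B1: «`R2OddHigh` PARKED = B′
`SteeredStallRebase` + Φ5») re-bases the datum at a member `R N` of a σ_top-STEERED run — a tower of LOCAL BLOWINGS UP
of `(A₀)_{𝔪_O ∩ A₀}` along permissible centres with respect to the valuation ring `O` (Novacoski–Spivakovsky
Def. 2.8 / 2.11, tree `IsLocalBlowup` / `IsLocalBlowupAlong`) — and feeds the re-based datum `(A', s N)` back into the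
phase machine (`concl_or_coreDatum`). The landed `genRebase` (p495493, `…SteerCore4GenExit`) does this along the
POINT sequence (`IsQuadraticTransformAlong`); this file proves the same bookkeeping fact along ARBITRARY towers of
local blowings up, with the regularity of the member taken as a HYPOTHESIS (it is the landed piece M: p501181
`SteeredRun.isRegularLocalRing_of_steeredRunUpTo`, resp. `SteeredMembersRegular.isRegularLocalRing_steps`).

* `SteeredRebase.rebase_of_model` — the model step in isolation: if `S = (A₁)_{𝔪_O ∩ A₁}` inside `K` for a finitely
  generated model `A₀ ≤ A₁ ⊆ O`, `w ^ p ∈ S`, `t ∈ S[w]`, `Frac (A₀[t]) = K` and `S` is a regular local ring, then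
  some finitely generated `A' ⊇ A₀` inside `O` has `locAtCentre A' O = S`, `w ^ p ∈ A'`, `t ∈ A'[w]`,
  `Frac (A'[w]) = K`, is regular at the centre of `O`, and every regular model of `(A', w)` is one of `(A₀, t)`.
  (`A' = A₁[d⁻¹]` for ONE common unit denominator `d`, exactly as in `genRebase`.)
* `SteeredRebase.steeredRebase` — **B′'s kernel**: along a tower `R 0 = (A₀)_{𝔪_O ∩ A₀} → R 1 → ⋯ → R N` of local
  blowings up with respect to `O` carrying strict-transform steps `s i = x_i · s (i+1) + g_i` (`x_i, g_i ∈ R i`,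
  `s 0 = t`) with `(s N) ^ p ∈ R N` and `R N` regular, the datum re-bases at `(A', s N)` with
  `locAtCentre A' O = R N` (model: `SteeredExit.exists_model_of_tower`, p497302; `t ∈ (R N)[s N]`:
  `SteeredExit.mem_closure_insert_of_steps`).
* `SteeredRebase.steeredRebase_of_run` — the same in the σ-line's RUN SHAPE (third conjunct of the sketch's
  `IsSteeredRunUpTo`, generic in the centre predicate `Perm` exactly as p501181
  `SteeredRun.isRegularLocalRing_of_steeredRunUpTo` / p499045 `steeredRun_dichotomy`), with the regularity of the
  member DISCHARGED by p501181 from the datum's regularity at the centre of `O`: the by-name leaf for B′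
  `SteeredStallRebase` (when the holder types it) is `obtain`/`exact`.

No multiplicity / exit / stall hypothesis and no binder of the skeleton's `CoreDatum` beyond `A₀.FG` and
`Frac (A₀[t]) = K` is used; `Concl` is UNFOLDED verbatim. [cite: NovacoskiSpivakovsky2014, Def. 2.8, Def. 2.11,
Lemma 2.5, Lemma 2.9] [folklore]
-/

noncomputable section

-- `Summit.<S>.<S>.…` duplicates the summit name by design (single-problem summit).
set_option linter.dupNamespace false

open IsLocalRing

namespace Summit.ResolutionOfSingularities.ResolutionOfSingularities.Theorems.SwitchingDichotomy

open Literature.AlgebraicGeometry.Resolution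
open Summit.ResolutionOfSingularities.ResolutionOfSingularities.Theorems.PfaffLine
  (adjoin_insert_toSubring_le le_adjoin_insert mem_adjoin_insert fg_adjoin_insert)

namespace SteeredRebase

variable {k K : Type} [Field k] [Field K] [Algebra k K]

/-- **Re-basing over the local ring of a finitely generated model.** Let `A₀ ≤ A₁ ⊆ O` be finitely generated
`k`-subalgebras of `K`, `S = (A₁)_{𝔪_O ∩ A₁}` realised inside `K`, `Frac (A₀[t]) = K`, `w ^ p ∈ S`, `t ∈ S[w]`,
and suppose `S` is a regular local ring. Then there is a finitely generated `A' ⊇ A₀` inside `O` with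
`locAtCentre A' O = S`, `w ^ p ∈ A'`, `t ∈ A'[w]`, `Frac (A'[w]) = K`, regular at the centre of `O`; and a regular
model of `(A', w)` is a regular model of `(A₀, t)`. Proof: the finitely many unit denominators needed to write `t`
and `w ^ p` over `A₁[w]`, `A₁` are collected into ONE `d ∈ A₁` of value `0` (`GenExit.exists_div_eq_of_mem_closure_insert`)
and `A' := A₁[d⁻¹] ⊆ S`, so `locAtCentre A' O = S` by idempotence. [cite: NovacoskiSpivakovsky2014, Lemma 2.5]
[folklore] -/
theorem rebase_of_model (O : ValuationSubring K) (A₀ A₁ : Subalgebra k K) (h₁ : A₁.toSubring ≤ O.toSubring)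
    (hle : A₀ ≤ A₁) (hfg₁ : A₁.FG) (S : Subring K) (hS : locAtCentre A₁.toSubring O = S) (t w : K) (p : ℕ)
    (hfr : IsFractionRing (Algebra.adjoin k (insert t (A₀ : Set K))) K) (hwp : w ^ p ∈ S)
    (ht : t ∈ Subring.closure (insert w (S : Set K))) (hreg : IsRegularLocalRing S) :
    ∃ (A' : Subalgebra k K) (h' : A'.toSubring ≤ O.toSubring), A₀ ≤ A' ∧
      locAtCentre A'.toSubring O = S ∧ A'.FG ∧ w ^ p ∈ A' ∧
      t ∈ Algebra.adjoin k (insert w (A' : Set K)) ∧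
      IsFractionRing (Algebra.adjoin k (insert w (A' : Set K))) K ∧
      IsRegularLocalRing (Localization.AtPrime
        (Ideal.comap (Subring.inclusion h') (IsLocalRing.maximalIdeal O))) ∧
      ((∃ (A : Subalgebra k K) (h : A.toSubring ≤ O.toSubring), A' ≤ A ∧ w ∈ A ∧ A.FG ∧
          IsFractionRing A K ∧ IsRegularLocalRing (Localization.AtPrime
            (Ideal.comap (Subring.inclusion h) (IsLocalRing.maximalIdeal O)))) →
        ∃ (A : Subalgebra k K) (h : A.toSubring ≤ O.toSubring), A₀ ≤ A ∧ t ∈ A ∧ A.FG ∧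
          IsFractionRing A K ∧ IsRegularLocalRing (Localization.AtPrime
            (Ideal.comap (Subring.inclusion h) (IsLocalRing.maximalIdeal O)))) := by
  classical
  have hA₁S : A₁.toSubring ≤ S := hS ▸ le_locAtCentre A₁.toSubring O
  -- ### the denominators: `t = v / c`, `w ^ p = a / c₂` over `A₁[w]`, `A₁`
  have ht' : t ∈ Subring.closure (insert w (locAtCentre A₁.toSubring O : Set K)) := by
    rw [hS]
    exact ht
  obtain ⟨v, hv, c, hc, hvc, htv⟩ := GenExit.exists_div_eq_of_mem_closure_insert O A₁ w ht'
  have hwp' : w ^ p ∈ locAtCentre A₁.toSubring O := by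
    rw [hS]
    exact hwp
  obtain ⟨a, ha, c₂, hc₂, hvc₂, hwa⟩ := mem_locAtCentre_iff.mp hwp'
  have hc0 := ne_zero_of_valuation_eq_one hvc
  have hc20 := ne_zero_of_valuation_eq_one hvc₂
  -- one common unit denominator `d = c * c₂`
  set d : K := c * c₂ with hd_def
  have hd : d ∈ A₁ := A₁.mul_mem hc hc₂
  have hvd : O.valuation d = 1 := by rw [hd_def, map_mul, hvc, hvc₂, one_mul]
  have hvdi : O.valuation d⁻¹ = 1 := by rw [map_inv₀, hvd, inv_one]
  have hdO : d⁻¹ ∈ O.toSubring := (O.valuation_le_one_iff _).mp hvdi.le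
  have hdS : d⁻¹ ∈ S := by
    have h := inv_mem_locAtCentre (le_locAtCentre A₁.toSubring O hd) hvd
    rwa [hS] at h
  -- ### the model `A' = A₁[d⁻¹]`
  set A' : Subalgebra k K := Algebra.adjoin k (insert d⁻¹ (A₁ : Set K)) with hA'_def
  have h' : A'.toSubring ≤ O.toSubring := adjoin_insert_toSubring_le O.toSubring A₁ h₁ hdO
  have hA₁A' : A₁ ≤ A' := le_adjoin_insert A₁ d⁻¹
  have hdA' : d⁻¹ ∈ A' := mem_adjoin_insert A₁ d⁻¹
  have hA'S : A'.toSubring ≤ S := adjoin_insert_toSubring_le S A₁ hA₁S hdS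
  have hS' : locAtCentre A'.toSubring O = S := by
    refine le_antisymm ?_ ?_
    · calc locAtCentre A'.toSubring O ≤ locAtCentre S O := locAtCentre_mono O hA'S
        _ = S := by rw [← hS, locAtCentre_locAtCentre]
    · rw [← hS]
      exact locAtCentre_mono O fun x hx => hA₁A' hx
  -- `w ^ p ∈ A'` and `t ∈ A'[w]`
  have hwpA' : w ^ p ∈ A' := by
    rw [hwa, show a / c₂ = a * c * (c * c₂)⁻¹ by field_simp]
    exact A'.mul_mem (A'.mul_mem (hA₁A' ha) (hA₁A' hc)) hdA'
  have htA' : t ∈ Algebra.adjoin k (insert w (A' : Set K)) := by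
    rw [htv, show v / c = v * c₂ * (c * c₂)⁻¹ by field_simp]
    exact Subalgebra.mul_mem _ (Subalgebra.mul_mem _
      (Algebra.adjoin_mono (Set.insert_subset_insert fun x hx => hA₁A' hx) hv)
      (le_adjoin_insert A' w (hA₁A' hc₂))) (le_adjoin_insert A' w hdA')
  -- ### fraction field and regularity at the centre
  haveI := hfr
  have hA₀A' : A₀ ≤ A' := hle.trans hA₁A'
  have hfr' : IsFractionRing (Algebra.adjoin k (insert w (A' : Set K))) K :=
    isFractionRing_subalgebra_of_le (Algebra.adjoin k (insert t (A₀ : Set K))) _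
      (Algebra.adjoin_le (Set.insert_subset htA' fun x hx => le_adjoin_insert A' w (hA₀A' hx)))
  have hregA' : IsRegularLocalRing (locAtCentre A'.toSubring O) := by
    rw [hS']
    exact hreg
  refine ⟨A', h', hA₀A', hS', fg_adjoin_insert hfg₁ d⁻¹, hwpA', htA', hfr',
    (isRegularLocalRing_locAtCentre_iff h').mp hregA', ?_⟩
  -- ### push-down of regular models
  rintro ⟨A, h, hA'A, hwA, hfgA, hfrA, hregA⟩
  refine ⟨A, h, hA₀A'.trans hA'A, ?_, hfgA, hfrA, hregA⟩
  exact Algebra.adjoin_le (S := A) (Set.insert_subset hwA fun x hx => hA'A hx) htA'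

/-- **`steeredRebase` — B′'s kernel: every member of a steered run re-bases the datum** (vocabulary of the
chain's σ-line unfolded: only the `IsLocalBlowup` step and the memberships `x_i, g_i ∈ R i` of `IsStrictStepAlong`
are used, as in X `SteeredExit.concl_of_exit`). For fields `k ⊆ K`, a valuation ring `O` of `K`, a finitely
generated `k`-subalgebra `A₀ ⊆ O`, `t ∈ K` with `Frac (A₀[t]) = K`, a sequence `R : ℕ → Subring K` with
`R 0 = (A₀)_{𝔪_O ∩ A₀}` whose first `N` steps are local blowings up with respect to `O` carrying strict-transform
steps `s i = x_i · s (i+1) + g_i` (`x_i, g_i ∈ R i`, `s 0 = t`), `(s N) ^ p ∈ R N` and `R N` a REGULAR local ring: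
there is a finitely generated `A' ⊇ A₀` inside `O` with `locAtCentre A' O = R N`, `(s N) ^ p ∈ A'`, `t ∈ A'[s N]`,
`Frac (A'[s N]) = K`, regular at the centre of `O`; and every regular model of `(A', s N)` is a regular model of
`(A₀, t)` (`Concl O A' (s N) → Concl O A₀ t`, unfolded). [cite: NovacoskiSpivakovsky2014, Def. 2.8, Def. 2.11,
Lemma 2.5, Lemma 2.9] [folklore] -/
theorem steeredRebase (O : ValuationSubring K) (A₀ : Subalgebra k K) (h₀ : A₀.toSubring ≤ O.toSubring)
    (t : K) (hfg : A₀.FG) (hfr : IsFractionRing (Algebra.adjoin k (insert t (A₀ : Set K))) K)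
    (p : ℕ) (R : ℕ → Subring K) (hR0 : R 0 = locAtCentre A₀.toSubring O)
    (s : ℕ → K) (N : ℕ) (hs0 : s 0 = t)
    (hstep : ∀ i < N, IsLocalBlowup O (R i) (R (i + 1)) ∧
      ∃ x g : K, x ∈ R i ∧ g ∈ R i ∧ s i = x * s (i + 1) + g)
    (hsN : s N ^ p ∈ R N) (hreg : IsRegularLocalRing (R N)) :
    ∃ (A' : Subalgebra k K) (h' : A'.toSubring ≤ O.toSubring), A₀ ≤ A' ∧
      locAtCentre A'.toSubring O = R N ∧ A'.FG ∧ s N ^ p ∈ A' ∧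
      t ∈ Algebra.adjoin k (insert (s N) (A' : Set K)) ∧
      IsFractionRing (Algebra.adjoin k (insert (s N) (A' : Set K))) K ∧
      IsRegularLocalRing (Localization.AtPrime
        (Ideal.comap (Subring.inclusion h') (IsLocalRing.maximalIdeal O))) ∧
      ((∃ (A : Subalgebra k K) (h : A.toSubring ≤ O.toSubring), A' ≤ A ∧ s N ∈ A ∧ A.FG ∧
          IsFractionRing A K ∧ IsRegularLocalRing (Localization.AtPrime
            (Ideal.comap (Subring.inclusion h) (IsLocalRing.maximalIdeal O)))) →
        ∃ (A : Subalgebra k K) (h : A.toSubring ≤ O.toSubring), A₀ ≤ A ∧ t ∈ A ∧ A.FG ∧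
          IsFractionRing A K ∧ IsRegularLocalRing (Localization.AtPrime
            (Ideal.comap (Subring.inclusion h) (IsLocalRing.maximalIdeal O)))) := by
  obtain ⟨A₁, h₁, hle, hfg₁, hRN⟩ :=
    SteeredExit.exists_model_of_tower O A₀ h₀ hfg hR0 (N := N) fun i hi => (hstep i hi).1
  have ht : t ∈ Subring.closure (insert (s N) (R N : Set K)) :=
    SteeredExit.mem_closure_insert_of_steps hs0 (fun i hi => (hstep i hi).1.le) fun i hi => (hstep i hi).2
  exact rebase_of_model O A₀ A₁ h₁ hle hfg₁ (R N) hRN t (s N) p hfr hsN ht hreg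

/-- **B′ in run shape — every member of a σ_top-steered run from a datum regular at the centre of `O` re-bases the
datum.** The run clause is the third conjunct of the sketch's `IsSteeredRunUpTo O R P t p s N`, unfolded and generic
in the centre predicate `Perm` (only `Perm S f P → P ≠ ⊤ ∧ IsRegularLocalRing (S ⧸ P)` is consumed, through p501181
`SteeredRun.isRegularLocalRing_of_steeredRunUpTo`, which makes `R N` regular); the conclusion is that of
`steeredRebase` (`Concl` unfolded). No exit / stall / multiplicity hypothesis is used: a STALLING member is re-based
exactly like any other. [cite: NovacoskiSpivakovsky2014, Def. 2.11, Lemma 2.5, Lemma 2.9] [cite: Matsumura1987,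
Thm. 14.2] [folklore] -/
theorem steeredRebase_of_run
    (Perm : ∀ S : Subring K, IsLocalRing S → S → Ideal S → Prop) (p : ℕ)
    (hPerm : ∀ (S : Subring K) (hS : IsLocalRing S) (f : S) (P : Ideal S),
      Perm S hS f P → P ≠ ⊤ ∧ IsRegularLocalRing (S ⧸ P))
    (O : ValuationSubring K) (A₀ : Subalgebra k K) (h₀ : A₀.toSubring ≤ O.toSubring) (t : K)
    (hfg : A₀.FG) (hfr : IsFractionRing (Algebra.adjoin k (insert t (A₀ : Set K))) K)
    (hreg : IsRegularLocalRing (Localization.AtPrime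
      (Ideal.comap (Subring.inclusion h₀) (IsLocalRing.maximalIdeal O))))
    (R : ℕ → Subring K) (P : (i : ℕ) → Ideal (R i)) (s : ℕ → K) (N : ℕ)
    (hR0 : R 0 = locAtCentre A₀.toSubring O) (hs0 : s 0 = t) (hsN : s N ^ p ∈ R N)
    (hrun : ∀ i < N, ∃ (hL : IsLocalRing (R i)) (hs : s i ^ p ∈ R i),
      (Perm (R i) hL ⟨s i ^ p, hs⟩ (P i) ∨
        (P i = maximalIdeal (R i) ∧ (∀ Q : Ideal (R i), ¬ Perm (R i) hL ⟨s i ^ p, hs⟩ Q) ∧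
          ∃ g : R i, (⟨s i ^ p, hs⟩ : R i) - g ^ p ∈ maximalIdeal (R i) ^ p)) ∧
      IsLocalBlowupAlong O (R i) (P i) (R (i + 1)) ∧
      ∃ x g : K, ((∃ hx : x ∈ R i, (⟨x, hx⟩ : R i) ∈ P i) ∧ x ≠ 0 ∧
        ∀ y : R i, y ∈ P i → O.valuation (y : K) ≤ O.valuation x) ∧ g ∈ R i ∧
        s i = x * s (i + 1) + g) :
    ∃ (A' : Subalgebra k K) (h' : A'.toSubring ≤ O.toSubring), A₀ ≤ A' ∧
      locAtCentre A'.toSubring O = R N ∧ A'.FG ∧ s N ^ p ∈ A' ∧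
      t ∈ Algebra.adjoin k (insert (s N) (A' : Set K)) ∧
      IsFractionRing (Algebra.adjoin k (insert (s N) (A' : Set K))) K ∧
      IsRegularLocalRing (Localization.AtPrime
        (Ideal.comap (Subring.inclusion h') (IsLocalRing.maximalIdeal O))) ∧
      ((∃ (A : Subalgebra k K) (h : A.toSubring ≤ O.toSubring), A' ≤ A ∧ s N ∈ A ∧ A.FG ∧
          IsFractionRing A K ∧ IsRegularLocalRing (Localization.AtPrime
            (Ideal.comap (Subring.inclusion h) (IsLocalRing.maximalIdeal O)))) →
        ∃ (A : Subalgebra k K) (h : A.toSubring ≤ O.toSubring), A₀ ≤ A ∧ t ∈ A ∧ A.FG ∧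
          IsFractionRing A K ∧ IsRegularLocalRing (Localization.AtPrime
            (Ideal.comap (Subring.inclusion h) (IsLocalRing.maximalIdeal O)))) := by
  have hregN : IsRegularLocalRing (R N) :=
    SteeredRun.isRegularLocalRing_of_steeredRunUpTo Perm p hPerm O A₀ h₀ hreg R P s N hR0 hrun N le_rfl
  refine steeredRebase O A₀ h₀ t hfg hfr p R hR0 s N hs0 (fun i hi => ?_) hsN hregN
  obtain ⟨_, _, -, hbl, x, g, ⟨⟨hx, -⟩, -, -⟩, hg, he⟩ := hrun i hi
  exact ⟨hbl.isLocalBlowup, x, g, hx, hg, he⟩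

end SteeredRebase

end Summit.ResolutionOfSingularities.ResolutionOfSingularities.Theorems.SwitchingDichotomy

end
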